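/-
Copyright (c) 2026 the pub-hodgecm-mathlib formalisation cell (harness21).  Prover seat hodgecm-mathlib-K2Liu-p05 (g0): Track B «K2-LIT»,
#184♮ = hLiu418 = stmt-HodgeConjecture-24832; organ (R) «reduction to one-place slices» of socket #32d `sig_K2LiuDoublingHeightDecayLocal`
of `Cruxes/HLiu418/Lines/K2_Liu_CurveThetaSigs_U5d_ZetaS.lean` (ED. 1 a836627a4002dcd3 :224); REPORT-FIRST K2/STATUS 2026-09-04 (K2Liu-p05 (g0)).
-/
import Literature.NumberTheory.GelbartRogawski1991.DoubledUnitarySiegelPlaceComponents          -- ★ `IsSiegelM`, `isSiegelM_iff_fst_snd ∕ _forall_place`, `isSiegelDelta_locToAdelic_iff`, `locToAdelic`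
import Literature.NumberTheory.K2Lit.SiegelEisensteinSeriesDoubled                                -- ★ `isSiegelDelta_mul ∕ modDelta_mul` (re-exported), `modDelta_pos`
import Literature.NumberTheory.Automorphic.UnitaryGroupAdelicProduct                             -- ★ `archPart ∕ finPart ∕ archToAdelic_mul_finAdelicToAdelic`
import Literature.NumberTheory.Automorphic.UnitaryGroupPlaceInclusion                            -- ★ `inclPlaceAdelic`, `evalPlace_inclPlace(_of_ne)`, `commute_*`
import Summits.HodgeConjecture.HodgeConjecture.Theorems.K2LiuSiegelDoubledIwasawaCompact         -- ★ (I) `exists_isCompact_isSiegelDelta_mul` (K2Liu-p09)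
import HarnessLib

/-!
# Crux `HLiu418`, Track B road `K2_Liu`, unit U5d «`Z_S`», socket #32d — organ (R), file 1:
# QUASI-FACTORISATION OF A `P_Δ`-HEIGHT ALONG COMMUTING PLACE PROJECTIONS, `Φ(a·b) ≤ C·Φ(a)·Φ(b)`

Cell `hodgecm-mathlib`, crux item hLiu418 = `stmt-HodgeConjecture-24832`, route of record `HCCMUnconditional`; squad K2 ∕ K2Liu,
LEAD F0P6-plan (g10), planner K2Liu-plan (g2), prover K2Liu-p05 (g0).  THEOREMS ONLY (no `def`, no instance, no notation, no
named-fact hypothesis, no `sorry`, default heartbeats); lane `--supports stmt-HodgeConjecture-24832 --as helper` (count-neutral).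

WHY.  Socket #32d asks for the integrability of `x ↦ Φ(ι(ιA x_{∞S}, 1))^τ` on `G_∞ × G_S` for EVERY continuous height `Φ > 0` of type
`(P_Δ, modDelta)` on the doubled group `H(𝔸)`.  Such a `Φ` need not be a product of local heights, but it is one UP TO CONSTANTS along
elements supported on disjoint sets of places — which is all that `Integrable.mono'` needs to split the `G_∞ × G_S` integral into
one-place slices (file 2, `K2LiuDoublingHeightDecayLocalOfSlices`).  This file proves the quasi-factorisation from the GLOBAL Iwasawa
decomposition `H(𝔸) = P_Δ(𝔸)·K` (`K` compact, ★ `exists_isCompact_isSiegelDelta_mul`) alone: NO local Iwasawa decomposition, NO product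
structure of `Φ` or of `K` is used ([BorelJacquet1979, §4.1]; [Garrett2018, §3.2 Claim 3.2.1, §3.10]; [GelbartPiatetskishapiroRallis1987, Part A §2]).

WHAT IS PROVED.
* §1 `exists_apply_mul_le_mul` — for compact `K₁, K₂ ⊆ H(𝔸)` and continuous `Φ > 0`: `Φ(k₁k₂) ≤ C·Φ(k₁)Φ(k₂)` on `K₁ × K₂`.
* §2 **`exists_quasiFactorization`** — THE ABSTRACT LEMMA: `r₁, r₂ : H(𝔸) →* H(𝔸)` continuous, mapping `P_Δ(𝔸)` into itself, with
  commuting images; then there is `C > 0` with `Φ(a·b) ≤ C·Φ(a)·Φ(b)` whenever `r₁ a = a`, `r₂ b = b`.  Proof: `a = r₁(p k) = r₁p·r₁k`,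
  `b = r₂q·r₂l` (global Iwasawa), `ab = (r₁p·r₂q)·(r₁k·r₂l)` (commuting images), `Φ(ab) = modDelta(r₁p)modDelta(r₂q)·Φ(r₁k·r₂l)`
  (★ `isSiegelDelta_mul`, ★ `modDelta_mul`), and §1 on the compacts `r₁(K)`, `r₂(K)`.
* §3 THE PLACE PROJECTION `r_v = ι_v ∘ evalPlace v ∘ finPart` of `H(𝔸) = U(J^𝔻)(𝔸_{L⁺})` (★ `UnitaryGroup` component API with `N := n+n`,
  `J := hermD`; `ι_v` = ★ `locToAdelic v` = ★ `inclPlaceAdelic v`): it maps `P_Δ(𝔸)` into itself (`isSiegelDelta_locToAdelic_evalPlace`: the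
  Siegel block relation `h₁₁ + h₁₂ = h₂₁ + h₂₂` is entrywise, hence passes to the `w`-components — ★ `IsSiegelM.map`, ★ `isSiegelM_iff_forall_place`,
  ★ `isSiegelDelta_locToAdelic_iff`), is continuous, its image commutes with every element of trivial `v`-component
  (`commute_locToAdelic_of_evalPlace_eq_one`, from ★ `commute_archToAdelic_inclPlaceAdelic` + ★ `commute_inclPlace_of_evalPlace_eq_one`), it fixes
  the elements supported at `v` (`locToAdelic_evalPlace_eq_self`, component extensionality) and kills those of trivial `v`-component.
* §4 **`exists_quasiFactorization_place`** — the instance of §2 used by file 2: an element `a` of trivial `v`-component against an element `b`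
  supported at `v`, `C⁻¹·Φ(a)Φ(b) ≤ Φ(ab) ≤ C·Φ(a)Φ(b)`; the first projection is `x ↦ x·(r_v x)⁻¹`, a monoid endomorphism by §3's commutation.
  TWO-SIDED bounds throughout (the slicing needs `Φ(ab)^τ ≲ Φ(a)^τ Φ(b)^τ` also for NEGATIVE `τ`, the `N = 0` corner of #32d).

HONEST LABEL.  Count-neutral helper of the K2_Liu road (organ (R) of #32d; the one-place slice integrals — archimedean, split, non-split —
remain the open organs of #32d); it retires nothing by itself: `HC_CM` is proved only modulo the 7 printed citations (2 remaining named inputs: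
hLiu418 = `stmt-HodgeConjecture-24832`, h413 = `stmt-HodgeConjecture-24833`) until rung 0 closes.

## References
* [BorelJacquet1979] A. Borel, H. Jacquet, *Automorphic forms and automorphic representations*, PSPM 33.1 (1979): §4.1 (`G(𝔸) = G_∞ × G(𝔸_f)`,
  place components).
* [Garrett2018] P. Garrett, *Modern Analysis of Automorphic Forms by Example* (2018): §3.2 Claim 3.2.1 (`G = PK`), §3.10 (heights on Siegel sets).
* [GelbartPiatetskishapiroRallis1987] S. Gelbart, I. Piatetski-Shapiro, S. Rallis, LNM 1254 (1987): Part A §2 (the height `Δ(g)` of the doubling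
  method and its local factors).
-/

set_option autoImplicit false
-- the mandated namespace repeats the single-problem summit's segment (`HodgeConjecture.HodgeConjecture`)
set_option linter.dupNamespace false

noncomputable section

open scoped Matrix
open NumberField IsDedekindDomain

namespace Summit.HodgeConjecture.HodgeConjecture.Cruxes.HLiu418.K2LiuDoublingHeightQuasiFactorization

open Literature.NumberTheory.Automorphic Literature.NumberTheory.Automorphic.UnitaryGroup
open Literature.NumberTheory.GelbartRogawski1991 Literature.NumberTheory.GelbartRogawski1991.GRConstruction
open Literature.NumberTheory.K2Lit.SiegelDoubled
open Summit.HodgeConjecture.HodgeConjecture.Cruxes.HLiu418.K2LiuSiegelDoubledIwasawaCompact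

variable (L : Type) [Field L] [NumberField L] [IsCMField L]
variable {N M n : ℕ} (e : Fin N × Fin M ≃ Fin n)
  (dV : Fin N → L) (hdV : ∀ i, IsCMField.complexConj L (dV i) = dV i)
  (dW : Fin M → L) (hdW : ∀ i, IsCMField.complexConj L (dW i) = dW i)

/-! ## §1 A continuous positive function is quasi-multiplicative on compacts -/

/-- On compact sets `K₁, K₂ ⊆ H(𝔸)` a continuous positive `Φ` is QUASI-MULTIPLICATIVE: `Φ(k₁k₂) ≤ C·Φ(k₁)·Φ(k₂)` and
`Φ(k₁)·Φ(k₂) ≤ C·Φ(k₁k₂)` (both ratios are continuous functions on the compact `K₁ × K₂`). [cite: Garrett2018, §3.10] -/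
theorem exists_apply_mul_le_mul {Φ : HA L e dV hdV dW hdW → ℝ} (hΦc : Continuous Φ) (hΦpos : ∀ x, 0 < Φ x)
    {K₁ K₂ : Set (HA L e dV hdV dW hdW)} (hK₁ : IsCompact K₁) (hK₂ : IsCompact K₂) :
    ∃ C : ℝ, 0 < C ∧ ∀ k₁ ∈ K₁, ∀ k₂ ∈ K₂, Φ (k₁ * k₂) ≤ C * (Φ k₁ * Φ k₂) ∧ Φ k₁ * Φ k₂ ≤ C * Φ (k₁ * k₂) := by
  have hcont : Continuous fun q : HA L e dV hdV dW hdW × HA L e dV hdV dW hdW => Φ (q.1 * q.2) / (Φ q.1 * Φ q.2) :=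
    (hΦc.comp (continuous_fst.mul continuous_snd)).div ((hΦc.comp continuous_fst).mul (hΦc.comp continuous_snd))
      fun q => (mul_pos (hΦpos _) (hΦpos _)).ne'
  have hcont' : Continuous fun q : HA L e dV hdV dW hdW × HA L e dV hdV dW hdW => (Φ q.1 * Φ q.2) / Φ (q.1 * q.2) :=
    ((hΦc.comp continuous_fst).mul (hΦc.comp continuous_snd)).div (hΦc.comp (continuous_fst.mul continuous_snd))
      fun q => (hΦpos _).ne'
  obtain ⟨D, hD⟩ := (hK₁.prod hK₂).exists_bound_of_continuousOn hcont.continuousOn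
  obtain ⟨D', hD'⟩ := (hK₁.prod hK₂).exists_bound_of_continuousOn hcont'.continuousOn
  refine ⟨max (max D D') 1, lt_of_lt_of_le one_pos (le_max_right _ _), fun k₁ hk₁ k₂ hk₂ => ⟨?_, ?_⟩⟩
  · have hq := hD (k₁, k₂) (Set.mk_mem_prod hk₁ hk₂)
    rw [Real.norm_eq_abs] at hq
    have hpos : 0 < Φ k₁ * Φ k₂ := mul_pos (hΦpos _) (hΦpos _)
    have hratio : Φ (k₁ * k₂) / (Φ k₁ * Φ k₂) ≤ max (max D D') 1 :=
      ((le_abs_self _).trans hq).trans ((le_max_left _ _).trans (le_max_left _ _))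
    rwa [div_le_iff₀ hpos] at hratio
  · have hq := hD' (k₁, k₂) (Set.mk_mem_prod hk₁ hk₂)
    rw [Real.norm_eq_abs] at hq
    have hratio : (Φ k₁ * Φ k₂) / Φ (k₁ * k₂) ≤ max (max D D') 1 :=
      ((le_abs_self _).trans hq).trans ((le_max_right _ _).trans (le_max_left _ _))
    rwa [div_le_iff₀ (hΦpos _)] at hratio

/-! ## §2 The abstract quasi-factorisation along two commuting `P_Δ`-preserving projections -/

/-- **QUASI-FACTORISATION.**  Let `Φ > 0` be a continuous height of type `(P_Δ, modDelta)` on `H(𝔸)` (non-degenerate data: `dV i ≠ 0`, `dW i ≠ 0`,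
so that ★ `exists_isCompact_isSiegelDelta_mul` gives `H(𝔸) = P_Δ(𝔸)·K` with `K` compact), and let `r₁, r₂ : H(𝔸) →* H(𝔸)` be continuous,
map `P_Δ(𝔸)` into itself, and have commuting images.  Then there is `C > 0` such that `Φ(a·b) ≤ C·Φ(a)·Φ(b)` for all `a, b` with `r₁ a = a` and
`r₂ b = b`. [cite: GelbartPiatetskishapiroRallis1987, Part A §2] [cite: Garrett2018, §3.10] [cite: BorelJacquet1979, §4.1] -/
theorem exists_quasiFactorization (hdV0 : ∀ i, dV i ≠ 0) (hdW0 : ∀ i, dW i ≠ 0)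
    {Φ : HA L e dV hdV dW hdW → ℝ} (hΦc : Continuous Φ) (hΦpos : ∀ x, 0 < Φ x)
    (hΦ : ∀ p x : HA L e dV hdV dW hdW, IsSiegelDelta L e dV hdV dW hdW p →
      Φ (p * x) = modDelta L e dV hdV dW hdW p * Φ x)
    (r₁ r₂ : HA L e dV hdV dW hdW →* HA L e dV hdV dW hdW) (hr₁ : Continuous r₁) (hr₂ : Continuous r₂)
    (hr₁P : ∀ p, IsSiegelDelta L e dV hdV dW hdW p → IsSiegelDelta L e dV hdV dW hdW (r₁ p))
    (hr₂P : ∀ p, IsSiegelDelta L e dV hdV dW hdW p → IsSiegelDelta L e dV hdV dW hdW (r₂ p))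
    (hcomm : ∀ x y, r₁ x * r₂ y = r₂ y * r₁ x) :
    ∃ C : ℝ, 0 < C ∧ ∀ a b : HA L e dV hdV dW hdW, r₁ a = a → r₂ b = b →
      Φ (a * b) ≤ C * (Φ a * Φ b) ∧ Φ a * Φ b ≤ C * Φ (a * b) := by
  obtain ⟨K, hK, hIw⟩ := exists_isCompact_isSiegelDelta_mul L e dV hdV dW hdW hdV0 hdW0
  obtain ⟨C, hC, hCK⟩ := exists_apply_mul_le_mul L e dV hdV dW hdW hΦc hΦpos (hK.image hr₁) (hK.image hr₂)
  refine ⟨C, hC, fun a b ha hb => ?_⟩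
  obtain ⟨p, k, hp, hk, hpk⟩ := hIw a
  obtain ⟨q, l, hq, hl, hql⟩ := hIw b
  have ha' : a = r₁ p * r₁ k := by rw [← ha, hpk, map_mul]
  have hb' : b = r₂ q * r₂ l := by rw [← hb, hql, map_mul]
  have hab : a * b = (r₁ p * r₂ q) * (r₁ k * r₂ l) := by
    rw [ha', hb', mul_assoc, mul_assoc, ← mul_assoc (r₁ k), hcomm k q, mul_assoc]
  have hpq : IsSiegelDelta L e dV hdV dW hdW (r₁ p * r₂ q) := isSiegelDelta_mul L e dV hdV dW hdW (hr₁P p hp) (hr₂P q hq)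
  rw [hab, hΦ _ _ hpq, modDelta_mul L e dV hdV dW hdW (hr₁P p hp) (hr₂P q hq), ha', hb', hΦ _ _ (hr₁P p hp),
    hΦ _ _ (hr₂P q hq)]
  have h1 : 0 ≤ modDelta L e dV hdV dW hdW (r₁ p) := (modDelta_pos L e dV hdV dW hdW _).le
  have h2 : 0 ≤ modDelta L e dV hdV dW hdW (r₂ q) := (modDelta_pos L e dV hdV dW hdW _).le
  have hkl := hCK (r₁ k) (Set.mem_image_of_mem _ hk) (r₂ l) (Set.mem_image_of_mem _ hl)
  constructor
  · calc modDelta L e dV hdV dW hdW (r₁ p) * modDelta L e dV hdV dW hdW (r₂ q) * Φ (r₁ k * r₂ l)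
        ≤ modDelta L e dV hdV dW hdW (r₁ p) * modDelta L e dV hdV dW hdW (r₂ q) * (C * (Φ (r₁ k) * Φ (r₂ l))) :=
          mul_le_mul_of_nonneg_left hkl.1 (mul_nonneg h1 h2)
      _ = C * (modDelta L e dV hdV dW hdW (r₁ p) * Φ (r₁ k) * (modDelta L e dV hdV dW hdW (r₂ q) * Φ (r₂ l))) := by ring
  · calc modDelta L e dV hdV dW hdW (r₁ p) * Φ (r₁ k) * (modDelta L e dV hdV dW hdW (r₂ q) * Φ (r₂ l))
        = modDelta L e dV hdV dW hdW (r₁ p) * modDelta L e dV hdV dW hdW (r₂ q) * (Φ (r₁ k) * Φ (r₂ l)) := by ring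
      _ ≤ modDelta L e dV hdV dW hdW (r₁ p) * modDelta L e dV hdV dW hdW (r₂ q) * (C * Φ (r₁ k * r₂ l)) :=
          mul_le_mul_of_nonneg_left hkl.2 (mul_nonneg h1 h2)
      _ = C * (modDelta L e dV hdV dW hdW (r₁ p) * modDelta L e dV hdV dW hdW (r₂ q) * Φ (r₁ k * r₂ l)) := by ring

/-! ## §3 The place projection `r_v = ι_v ∘ evalPlace v ∘ finPart` of `H(𝔸)` and the elements of trivial `v`-component -/

section Place

variable (v : HeightOneSpectrum (𝓞 (Fp L)))

/-- **`r_v` maps `P_Δ(𝔸)` into itself**: the Siegel relation `h₁₁ + h₁₂ = h₂₁ + h₂₂` is entrywise in `𝔸_L`, so it passes to the finite part,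
to the `w`-component for every `w ∣ v` (★ `isSiegelM_iff_fst_snd`, ★ `isSiegelM_iff_forall_place`), and back to `ι_v(h_v)` (★ `isSiegelDelta_locToAdelic_iff`).
[cite: BorelJacquet1979, §4.1] [cite: GelbartPiatetskishapiroRallis1987, Part A §2] -/
theorem isSiegelDelta_locToAdelic_evalPlace (p : HA L e dV hdV dW hdW) (hp : IsSiegelDelta L e dV hdV dW hdW p) :
    IsSiegelDelta L e dV hdV dW hdW (locToAdelic L e dV hdV dW hdW v
      (UnitaryGroup.evalPlace (Fp L) L (IsCMField.complexConj L) (n + n) (hermD L e dV hdV dW hdW) v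
        (UnitaryGroup.finPart (Fp L) L (IsCMField.complexConj L) (n + n) (hermD L e dV hdV dW hdW) p))) := by
  rw [isSiegelDelta_locToAdelic_iff]
  intro w
  have h1 : IsSiegelM ((((p : HA L e dV hdV dW hdW) : GL (Fin (n + n)) (AdeleRing (𝓞 L) L)) :
      Matrix (Fin (n + n)) (Fin (n + n)) (AdeleRing (𝓞 L) L)).map (UnitaryGroup.adeleSnd L)) :=
    ((isSiegelDelta_iff_isSiegelM L e dV hdV dW hdW p).1 hp).map (n := n) _
  have h2 := (isSiegelM_iff_forall_place L _).1 h1 w.1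
  rw [UnitaryGroup.coe_evalPlace_apply, ← UnitaryGroup.map_eval_eq_evalAt]
  exact h2

/-- `r_v` is continuous. [cite: BorelJacquet1979, §4.1] -/
theorem continuous_locToAdelic_evalPlace_finPart :
    Continuous fun x : HA L e dV hdV dW hdW => locToAdelic L e dV hdV dW hdW v
      (UnitaryGroup.evalPlace (Fp L) L (IsCMField.complexConj L) (n + n) (hermD L e dV hdV dW hdW) v
        (UnitaryGroup.finPart (Fp L) L (IsCMField.complexConj L) (n + n) (hermD L e dV hdV dW hdW) x)) :=
  (UnitaryGroup.continuous_inclPlaceAdelic (Fp L) L (IsCMField.complexConj L) (n + n) (hermD L e dV hdV dW hdW) v).comp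
    ((UnitaryGroup.continuous_evalPlace (Fp L) L (IsCMField.complexConj L) (n + n) (hermD L e dV hdV dW hdW) v).comp
      (UnitaryGroup.continuous_finPart (Fp L) L (IsCMField.complexConj L) (n + n) (hermD L e dV hdV dW hdW)))

/-- **An element of trivial `v`-component commutes with `ι_v(H(L⁺_v))`** (`x = (x_∞, 1)·(1, x_f)`; ★ `commute_archToAdelic_inclPlaceAdelic`,
★ `commute_inclPlace_of_evalPlace_eq_one`). [cite: BorelJacquet1979, §4.1] -/
theorem commute_locToAdelic_of_evalPlace_eq_one (x : HA L e dV hdV dW hdW)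
    (hx : UnitaryGroup.evalPlace (Fp L) L (IsCMField.complexConj L) (n + n) (hermD L e dV hdV dW hdW) v
      (UnitaryGroup.finPart (Fp L) L (IsCMField.complexConj L) (n + n) (hermD L e dV hdV dW hdW) x) = 1)
    (u : UnitaryGroup.localPi L (IsCMField.complexConj L) (n + n) (hermD L e dV hdV dW hdW) v) :
    Commute x (locToAdelic L e dV hdV dW hdW v u) := by
  have hdec := UnitaryGroup.archToAdelic_mul_finAdelicToAdelic (Fp L) L (IsCMField.complexConj L) (n + n)
    (hermD L e dV hdV dW hdW) x
  rw [← hdec]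
  refine Commute.mul_left (UnitaryGroup.commute_archToAdelic_inclPlaceAdelic (Fp L) L (IsCMField.complexConj L) (n + n)
    (hermD L e dV hdV dW hdW) _ v u) ?_
  show Commute _ (UnitaryGroup.finAdelicToAdelic (Fp L) L (IsCMField.complexConj L) (n + n) (hermD L e dV hdV dW hdW)
    (UnitaryGroup.inclPlace (Fp L) L (IsCMField.complexConj L) (n + n) (hermD L e dV hdV dW hdW) v u))
  exact (UnitaryGroup.commute_inclPlace_of_evalPlace_eq_one (Fp L) L (IsCMField.complexConj L) (n + n)
    (hermD L e dV hdV dW hdW) hx u).map _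

/-- **`r_v` fixes the elements supported at `v`**: if `x_∞ = 1` and `x_w = 1` for every `w ≠ v` then `ι_v(x_v) = x` (component extensionality,
★ `adelicProdEquiv`, ★ `eq_of_forall_evalPlace_eq`). [cite: BorelJacquet1979, §4.1] -/
theorem locToAdelic_evalPlace_eq_self (x : HA L e dV hdV dW hdW)
    (harch : UnitaryGroup.archPart (Fp L) L (IsCMField.complexConj L) (n + n) (hermD L e dV hdV dW hdW) x = 1)
    (hfin : ∀ w : HeightOneSpectrum (𝓞 (Fp L)), w ≠ v →
      UnitaryGroup.evalPlace (Fp L) L (IsCMField.complexConj L) (n + n) (hermD L e dV hdV dW hdW) w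
        (UnitaryGroup.finPart (Fp L) L (IsCMField.complexConj L) (n + n) (hermD L e dV hdV dW hdW) x) = 1) :
    locToAdelic L e dV hdV dW hdW v
      (UnitaryGroup.evalPlace (Fp L) L (IsCMField.complexConj L) (n + n) (hermD L e dV hdV dW hdW) v
        (UnitaryGroup.finPart (Fp L) L (IsCMField.complexConj L) (n + n) (hermD L e dV hdV dW hdW) x)) = x := by
  refine (UnitaryGroup.adelicProdEquiv (Fp L) L (IsCMField.complexConj L) (n + n) (hermD L e dV hdV dW hdW)).injective
    (Prod.ext ?_ (UnitaryGroup.eq_of_forall_evalPlace_eq (Fp L) L (IsCMField.complexConj L) (n + n) (hermD L e dV hdV dW hdW)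
      fun w => ?_))
  · show UnitaryGroup.archPart (Fp L) L (IsCMField.complexConj L) (n + n) (hermD L e dV hdV dW hdW)
        (UnitaryGroup.inclPlaceAdelic (Fp L) L (IsCMField.complexConj L) (n + n) (hermD L e dV hdV dW hdW) v _) =
      UnitaryGroup.archPart (Fp L) L (IsCMField.complexConj L) (n + n) (hermD L e dV hdV dW hdW) x
    rw [UnitaryGroup.archPart_inclPlaceAdelic, harch]
  · show UnitaryGroup.evalPlace (Fp L) L (IsCMField.complexConj L) (n + n) (hermD L e dV hdV dW hdW) w
        (UnitaryGroup.finPart (Fp L) L (IsCMField.complexConj L) (n + n) (hermD L e dV hdV dW hdW)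
          (UnitaryGroup.inclPlaceAdelic (Fp L) L (IsCMField.complexConj L) (n + n) (hermD L e dV hdV dW hdW) v _)) =
      UnitaryGroup.evalPlace (Fp L) L (IsCMField.complexConj L) (n + n) (hermD L e dV hdV dW hdW) w
        (UnitaryGroup.finPart (Fp L) L (IsCMField.complexConj L) (n + n) (hermD L e dV hdV dW hdW) x)
    rw [UnitaryGroup.finPart_inclPlaceAdelic]
    rcases eq_or_ne w v with rfl | hw
    · rw [UnitaryGroup.evalPlace_inclPlace]
    · rw [UnitaryGroup.evalPlace_inclPlace_of_ne (Fp L) L (IsCMField.complexConj L) (n + n) (hermD L e dV hdV dW hdW) hw, hfin w hw]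

/-- `r_v` kills the elements of trivial `v`-component: `ι_v(x_v) = 1` if `x_v = 1`. [cite: BorelJacquet1979, §4.1] -/
theorem locToAdelic_evalPlace_eq_one (x : HA L e dV hdV dW hdW)
    (hx : UnitaryGroup.evalPlace (Fp L) L (IsCMField.complexConj L) (n + n) (hermD L e dV hdV dW hdW) v
      (UnitaryGroup.finPart (Fp L) L (IsCMField.complexConj L) (n + n) (hermD L e dV hdV dW hdW) x) = 1) :
    locToAdelic L e dV hdV dW hdW v
      (UnitaryGroup.evalPlace (Fp L) L (IsCMField.complexConj L) (n + n) (hermD L e dV hdV dW hdW) v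
        (UnitaryGroup.finPart (Fp L) L (IsCMField.complexConj L) (n + n) (hermD L e dV hdV dW hdW) x)) = 1 := by
  rw [hx, map_one]

/-- the `v`-component of `x · (ι_v x_v)⁻¹` is trivial. [cite: BorelJacquet1979, §4.1] -/
theorem evalPlace_finPart_mul_inv_locToAdelic (x : HA L e dV hdV dW hdW) :
    UnitaryGroup.evalPlace (Fp L) L (IsCMField.complexConj L) (n + n) (hermD L e dV hdV dW hdW) v
      (UnitaryGroup.finPart (Fp L) L (IsCMField.complexConj L) (n + n) (hermD L e dV hdV dW hdW)
        (x * (locToAdelic L e dV hdV dW hdW v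
          (UnitaryGroup.evalPlace (Fp L) L (IsCMField.complexConj L) (n + n) (hermD L e dV hdV dW hdW) v
            (UnitaryGroup.finPart (Fp L) L (IsCMField.complexConj L) (n + n) (hermD L e dV hdV dW hdW) x)))⁻¹)) = 1 := by
  let π : ↥(HA L e dV hdV dW hdW) →* UnitaryGroup.localPi L (IsCMField.complexConj L) (n + n) (hermD L e dV hdV dW hdW) v :=
    (UnitaryGroup.evalPlace (Fp L) L (IsCMField.complexConj L) (n + n) (hermD L e dV hdV dW hdW) v).comp
      (UnitaryGroup.finPart (Fp L) L (IsCMField.complexConj L) (n + n) (hermD L e dV hdV dW hdW))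
  change π (x * (locToAdelic L e dV hdV dW hdW v (π x))⁻¹) = 1
  have hfix : π (locToAdelic L e dV hdV dW hdW v (π x)) = π x :=
    UnitaryGroup.evalPlace_finPart_inclPlaceAdelic (Fp L) L (IsCMField.complexConj L) (n + n) (hermD L e dV hdV dW hdW) v (π x)
  rw [map_mul, map_inv, hfix, mul_inv_cancel]

end Place

/-! ## §4 The quasi-factorisation used by the slicing of `G_∞ × G_S`: trivial `v`-component against supported at `v` -/

set_option maxHeartbeats 400000 in
/-- **QUASI-FACTORISATION ACROSS ONE FINITE PLACE.**  For non-degenerate data, a continuous height `Φ > 0` of type `(P_Δ, modDelta)` on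
`H(𝔸)`, and a finite place `v` of `L⁺`, there is `C > 0` such that for every `a ∈ H(𝔸)` with trivial `v`-component and every `b ∈ H(𝔸)`
supported at `v` (`b_∞ = 1`, `b_w = 1` for `w ≠ v`): `Φ(ab) ≤ C·Φ(a)Φ(b)` and `Φ(a)Φ(b) ≤ C·Φ(ab)`.  (§2 with `r₁ = x ↦ x·(ι_v x_v)⁻¹` — a monoid
endomorphism by §3's commutation — and `r₂ = r_v`.) [cite: GelbartPiatetskishapiroRallis1987, Part A §2] [cite: BorelJacquet1979, §4.1] [cite: Garrett2018, §3.10] -/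
theorem exists_quasiFactorization_place (hdV0 : ∀ i, dV i ≠ 0) (hdW0 : ∀ i, dW i ≠ 0)
    {Φ : HA L e dV hdV dW hdW → ℝ} (hΦc : Continuous Φ) (hΦpos : ∀ x, 0 < Φ x)
    (hΦ : ∀ p x : HA L e dV hdV dW hdW, IsSiegelDelta L e dV hdV dW hdW p →
      Φ (p * x) = modDelta L e dV hdV dW hdW p * Φ x)
    (v : HeightOneSpectrum (𝓞 (Fp L))) :
    ∃ C : ℝ, 0 < C ∧ ∀ a b : HA L e dV hdV dW hdW,
      UnitaryGroup.evalPlace (Fp L) L (IsCMField.complexConj L) (n + n) (hermD L e dV hdV dW hdW) v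
          (UnitaryGroup.finPart (Fp L) L (IsCMField.complexConj L) (n + n) (hermD L e dV hdV dW hdW) a) = 1 →
        UnitaryGroup.archPart (Fp L) L (IsCMField.complexConj L) (n + n) (hermD L e dV hdV dW hdW) b = 1 →
        (∀ w : HeightOneSpectrum (𝓞 (Fp L)), w ≠ v →
          UnitaryGroup.evalPlace (Fp L) L (IsCMField.complexConj L) (n + n) (hermD L e dV hdV dW hdW) w
            (UnitaryGroup.finPart (Fp L) L (IsCMField.complexConj L) (n + n) (hermD L e dV hdV dW hdW) b) = 1) →
        Φ (a * b) ≤ C * (Φ a * Φ b) ∧ Φ a * Φ b ≤ C * Φ (a * b) := by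
  -- `π = evalPlace v ∘ finPart` and `r₂ = r_v = ι_v ∘ π`, as endomorphisms of `↥H(𝔸)`
  let π : ↥(HA L e dV hdV dW hdW) →* UnitaryGroup.localPi L (IsCMField.complexConj L) (n + n) (hermD L e dV hdV dW hdW) v :=
    (UnitaryGroup.evalPlace (Fp L) L (IsCMField.complexConj L) (n + n) (hermD L e dV hdV dW hdW) v).comp
      (UnitaryGroup.finPart (Fp L) L (IsCMField.complexConj L) (n + n) (hermD L e dV hdV dW hdW))
  let r₂ : ↥(HA L e dV hdV dW hdW) →* ↥(HA L e dV hdV dW hdW) := (locToAdelic L e dV hdV dW hdW v).comp π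
  have hr₂a : ∀ x, r₂ x = locToAdelic L e dV hdV dW hdW v (π x) := fun x => rfl
  have hπr₂ : ∀ x, π (r₂ x) = π x := fun x =>
    UnitaryGroup.evalPlace_finPart_inclPlaceAdelic (Fp L) L (IsCMField.complexConj L) (n + n) (hermD L e dV hdV dW hdW) v (π x)
  have hκ1 : ∀ x, π (x * (r₂ x)⁻¹) = 1 := fun x => by rw [map_mul, map_inv, hπr₂, mul_inv_cancel]
  have hc0 : ∀ (x : ↥(HA L e dV hdV dW hdW)) (u : UnitaryGroup.localPi L (IsCMField.complexConj L) (n + n) (hermD L e dV hdV dW hdW) v),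
      π x = 1 → Commute x (locToAdelic L e dV hdV dW hdW v u) :=
    fun x u hx => commute_locToAdelic_of_evalPlace_eq_one L e dV hdV dW hdW v x hx u
  -- `r₁ = x ↦ x · (r_v x)⁻¹`, a monoid endomorphism because `r_v x` commutes with elements of trivial `v`-component
  let r₁ : ↥(HA L e dV hdV dW hdW) →* ↥(HA L e dV hdV dW hdW) := MonoidHom.mk' (fun x => x * (r₂ x)⁻¹) fun x y => by
    have hc : Commute (y * (r₂ y)⁻¹) (r₂ x)⁻¹ := by
      have h := hc0 _ (π x)⁻¹ (hκ1 y)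
      rwa [map_inv] at h
    rw [map_mul, mul_inv_rev]
    simp only [mul_assoc]
    congr 1
    rw [← mul_assoc]
    exact hc.eq
  have hr₁a : ∀ x, r₁ x = x * (r₂ x)⁻¹ := fun x => congrFun (MonoidHom.mk'_apply _ _) x
  have hr₂c : Continuous r₂ := continuous_locToAdelic_evalPlace_finPart L e dV hdV dW hdW v
  have hr₁c : Continuous r₁ := by
    have h : Continuous fun x : ↥(HA L e dV hdV dW hdW) => x * (r₂ x)⁻¹ := continuous_id.mul hr₂c.inv
    exact h.congr fun x => (hr₁a x).symm
  have hr₂P : ∀ p, IsSiegelDelta L e dV hdV dW hdW p → IsSiegelDelta L e dV hdV dW hdW (r₂ p) :=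
    fun p hp => isSiegelDelta_locToAdelic_evalPlace L e dV hdV dW hdW v p hp
  have hr₁P : ∀ p, IsSiegelDelta L e dV hdV dW hdW p → IsSiegelDelta L e dV hdV dW hdW (r₁ p) :=
    fun p hp => by
      rw [hr₁a]
      exact isSiegelDelta_mul L e dV hdV dW hdW hp (isSiegelDelta_inv L e dV hdV dW hdW (hr₂P p hp))
  have hcomm : ∀ x y, r₁ x * r₂ y = r₂ y * r₁ x := fun x y => by
    rw [hr₂a y]
    exact (hc0 _ _ (hκ1 x)).eq
  obtain ⟨C, hC, hq⟩ := exists_quasiFactorization L e dV hdV dW hdW hdV0 hdW0 hΦc hΦpos hΦ r₁ r₂ hr₁c hr₂c hr₁P hr₂P hcomm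
  refine ⟨C, hC, fun a b ha hb hbw => hq a b ?_ ?_⟩
  · have ha' : π a = 1 := ha
    rw [hr₁a, hr₂a, ha', map_one, inv_one, mul_one]
  · rw [hr₂a]
    exact locToAdelic_evalPlace_eq_self L e dV hdV dW hdW v b hb hbw

end Summit.HodgeConjecture.HodgeConjecture.Cruxes.HLiu418.K2LiuDoublingHeightQuasiFactorization

end
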